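import Summits.BirchSwinnertonDyer.BirchSwinnertonDyer.Theorems.GenusKolyvaginAtTwoVisiblePairAtTwoLevelTransfer
import Summits.BirchSwinnertonDyer.BirchSwinnertonDyer.Theorems.GenusKolyvaginAtTwoEquivariantKolyvaginExactAtTwoReciprocityPair
import Summits.BirchSwinnertonDyer.BirchSwinnertonDyer.Theorems.GenusKolyvaginAtTwoEquivariantKolyvaginExactAtTwoLocalPairingPrime
import Literature.NumberTheory.EllipticCurves.HeegnerPointsKolyvaginVisibleDescentDeepeningProofs
import HarnessLib

/-!
# Route `GenusKolyvaginAtTwo`, LINE 6, KEY crux Q3 (inner statement of stmt-BirchSwinnertonDyer-22137):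
# the DEEPENING STEP for the ℚ-pair instance — McCallum's Prop. 5.2 (`r = 1`) at `p = 2` with its
# Čebotarev, reciprocity and local-duality inputs DISCHARGED (helper, PROVED; seat `bsd-line-gk2-p2` g11)

The exactness theorem of the visible pair descent consumes a DEEP depth-one certificate (a `2`-primitive
`c₂(ℓ)` at a Kolyvagin prime `ℓ` of the instance, `kolPrime W K M ℓ`, level `2^M`), while Kolyvagin's
hypothesis — and the route's crux — is a SHALLOW one (`P_{ℓ₀} ∉ 2E(K_{ℓ₀})` at a prime `ℓ₀` of level `2`).
The abstract passage is `KolyvaginDescent.exists_deep_certificate_of_shallow_of_transfer`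
(`Literature/…/HeegnerPointsKolyvaginVisibleDescentDeepeningProofs`, McCallum p. 286–287). This file
instantiates it for the ℚ-pair `(E, E^{(d_K)})` at `2` in the currency of seat gk2-p3's `…VisiblePairAtTwoDefs`
(`Deep = kolPrime W K M`, `pl`, `LocU = loc₁ W 1`, `AU = a₁ W 1`, `AY = a₂ W K 1`, local pairings = the
Weil cup product `(a_v ∪ₑ c_v)` on `H¹(ℚ_v, E[2])`), DISCHARGING:

* `hceb` — `exists_kolPrime_not_mem_of_visible_pair` (`…LevelTransfer`, from `input_cebotarev`);
* `hrec` — the two-place reciprocity `cupProduct_localization_eq_zero_iff_of_selmer_off_pair'`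
  (`…ReciprocityPair`, Poitou–Tate over `ℚ`);
* `hndeg` — `cupProduct_localization_ne_zero_of_not_mem_of_mem` (`…LocalPairingPrime`: `𝓛_v^⊥ = 𝓛_v`
  and `#E(ℚ_ℓ)[2] = 2` at a Gross–Kolyvagin prime, `ReductionCyclic.natCard_ker_zsmul_adicCompletion_two_pow_eq`);
* `hstrict` — `cupProduct_localization_eq_zero_of_mem_torsionLocalKer`;
* `hpl` — distinct primes have distinct places.

What stays DISPLAYED (all at level `2`, all in print): the auxiliary class `u ≠ 0` Selmer off `ℓ₀`
(McCallum (7)–(8), Lemma 5.3 (2)); the classes `c_1(ℓ₀)` (`y₀`), `c_1(ℓ₀ℓ)` (`uu ℓ`), `c_1(ℓ)` (`w ℓ`)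
with Lemma 4.3 (`h43`) and Prop. 4.4 at `λ` and at `λ₀` (`h44sel`, `h44ord` — the route's Q2 at level `2`);
non-vanishing and visibility of the embedded pair `{ι u, ι y₀}` at level `2^M`; and, for the final reading,
the link `hlink` (`c_1(ℓ)_{λ₀} ≠ 0 ⟹ 2^{M−1} c₂(ℓ) ≠ 0`, Lemma 4.6).

* `exists_deep_certificate` — **`∀ b ∃ ℓ > b`, `kolPrime W K M ℓ`, `ℓ ≠ ℓ₀`, `c_1(ℓ) ∉ a₂ W K 1 ℓ₀`**;
* `exists_kolPrime_pow_zsmul_ne_zero` — with `hlink`: **`∃ ℓ`, `kolPrime W K M ℓ ∧ 2^{M−1}·c₂ ℓ ≠ 0`**, the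
  certificate consumed by `VisiblePairHypothesesM.sel₁_eq_and_card_sel₂_eq_of_primitive`.

Helper (`--supports` 22137), closes nothing; THEOREMS ONLY, 0 sorry, standard axioms. Nothing here is a claim
about BSD, about Q2, or about (H2).

References: [McCallumLMS1991] §5 Prop. 5.2 (proof, (7)–(13)), Lemma 5.3, §2 Prop. 2.2, §4 Lemma 4.3,
Prop. 4.4, Lemma 4.6; [MilneADT2006] I Thm. 4.10(b), Cor. 3.4; [Kolyvagin1989Izv] §3.
-/

set_option autoImplicit false
set_option linter.dupNamespace false -- tree convention: `Summit.BirchSwinnertonDyer.BirchSwinnertonDyer.Theorems` (summit = sub-problem)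

noncomputable section

open scoped Classical Pointwise

namespace Summit.BirchSwinnertonDyer.BirchSwinnertonDyer.Theorems.GenusExact.VisiblePairAtTwo

open WeierstrassCurve NumberField IsDedekindDomain Field Finset Rat.HeightOneSpectrum
open Literature.NumberTheory.EllipticCurves Literature.NumberTheory.GaloisRepresentations
open Literature.NumberTheory.GaloisCohomology
open Literature.NumberTheory.EllipticCurves.KolyvaginDescent
open Summit.BirchSwinnertonDyer.BirchSwinnertonDyer.Theorems.GenusExact.FrobeniusCriterion

variable (W : WeierstrassCurve ℚ) [W.IsElliptic] [W.IsGloballyMinimal] (K : Type) [Field K] [NumberField K]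
  (M : ℕ) {θ : K} (hθ : θ ∉ Set.range (algebraMap ℚ K))
  (hθsq : θ ^ 2 = algebraMap ℚ K ((NumberField.discr K : ℤ) : ℚ))

/-! ## §1 Plumbing: places of primes, the local conditions of the instance at level `2` -/

omit [W.IsElliptic] [W.IsGloballyMinimal] in
/-- Distinct primes have distinct places (`pl` is injective on primes). [folklore] -/
theorem pl_ne_pl_of_ne {ℓ ℓ' : ℕ} (hℓ : ℓ.Prime) (hℓ' : ℓ'.Prime) (hne : ℓ ≠ ℓ') : pl ℓ ≠ pl ℓ' := by
  rw [pl_of_prime hℓ, pl_of_prime hℓ']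
  intro h
  have h1 := primesEquiv.symm.injective (Sum.inl_injective h)
  exact hne (congrArg Subtype.val h1)

omit [W.IsElliptic] [W.IsGloballyMinimal] in
/-- `loc₁` at a finite place is the Selmer local condition there. [folklore] -/
theorem mem_loc₁_inl_iff (N : ℕ) (v : HeightOneSpectrum (𝓞 ℚ)) (a : galH1Torsion W (lvl N)) :
    a ∈ loc₁ W N (Sum.inl v) ↔ a ∈ selmerLocalKer W (v.adicCompletion ℚ) (lvl N) := Iff.rfl

omit [W.IsElliptic] [W.IsGloballyMinimal] in
/-- `loc₁` at an infinite place is the Selmer local condition there. [folklore] -/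
theorem mem_loc₁_inr_iff (N : ℕ) (w : InfinitePlace ℚ) (a : galH1Torsion W (lvl N)) :
    a ∈ loc₁ W N (Sum.inr w) ↔ a ∈ selmerLocalKer W w.Completion (lvl N) := Iff.rfl

omit [W.IsElliptic] [W.IsGloballyMinimal] in
/-- From "`a` Selmer at every place `≠ pl ℓ₀, pl ℓ`" (places of the instance) to the finite / infinite
Selmer conditions consumed by the reciprocity law. [folklore] -/
theorem selmer_off_of_forall_ne_pl {N : ℕ} {ℓ₀ ℓ : ℕ} (hℓ₀ : ℓ₀.Prime) (hℓ : ℓ.Prime)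
    {a : galH1Torsion W (lvl N)} (ha : ∀ v, v ≠ pl ℓ₀ → v ≠ pl ℓ → a ∈ loc₁ W N v) :
    (∀ w : HeightOneSpectrum (𝓞 ℚ), w ≠ primesEquiv.symm ⟨ℓ₀, hℓ₀⟩ → w ≠ primesEquiv.symm ⟨ℓ, hℓ⟩ →
        a ∈ selmerLocalKer W (w.adicCompletion ℚ) (lvl N)) ∧
      ∀ w : InfinitePlace ℚ, a ∈ selmerLocalKer W w.Completion (lvl N) := by
  refine ⟨fun w hw₀ hw ↦ ha (Sum.inl w) ?_ ?_, fun w ↦ ha (Sum.inr w) ?_ ?_⟩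
  · rw [pl_of_prime hℓ₀]; exact fun h ↦ hw₀ (Sum.inl_injective h)
  · rw [pl_of_prime hℓ]; exact fun h ↦ hw (Sum.inl_injective h)
  · rw [pl_of_prime hℓ₀]; exact Sum.inr_ne_inl
  · rw [pl_of_prime hℓ]; exact Sum.inr_ne_inl

/-! ## §2 The deepening step for the instance -/

/-- **McCallum's Prop. 5.2 (`r = 1`) for the ℚ-pair instance at `2`, inputs discharged down to print.**
Setting: the LINE-6 habitat (`E` globally minimal non-CM, `Δ < 0`, `ρ_{E,2^n}` onto for all `n`,
`K = ℚ(θ)` imaginary quadratic, `θ² = d_K` odd, `d_K·(−|Δ|)` not a square), `M ≥ 1`; a prime `ℓ₀` (the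
SHALLOW certificate prime); at level `2`: the class `y₀ = c_1(ℓ₀) ∈ H¹(ℚ, E^{(d_K)}[2])`, an auxiliary class
`u ∈ H¹(ℚ, E[2])` Selmer off `ℓ₀` (`hu`), the classes `uu ℓ = c_1(ℓ₀ℓ)`, `w ℓ = c_1(ℓ)` at the Kolyvagin
primes of the instance with Lemma 4.3 (`h43`) and Prop. 4.4 at `λ` / `λ₀` (`h44sel`, `h44ord`); the embedded
pair `ι u`, `ι y₀` at level `2^M` non-zero and visible (`hu0`, `hy0`, `hvis`). Conclusion: for every `b` a
Kolyvagin prime `ℓ > b` of the instance, `ℓ ≠ ℓ₀`, with **`c_1(ℓ) ∉ a₂ W K 1 ℓ₀`** (`c_1(ℓ)_{λ₀} ≠ 0`).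
[cite: McCallumLMS1991, §5 Prop. 5.2 (proof, (7)–(13)), Lemma 5.3, §2 Prop. 2.2, §4 Prop. 4.4] -/
theorem exists_deep_certificate (hcm : ¬ W.HasCM) (hΔ : W.Δ < 0) (hK : IsImaginaryQuadratic K)
    (hodd : Odd (NumberField.discr K)) (hns : ¬ IsSquare ((NumberField.discr K : ℚ) * -|W.Δ|))
    (hρ : ∀ n : ℕ, W.HasSurjectiveModNGaloisRep (2 ^ n : ℕ)) [(twin W K).IsElliptic] (hM : 1 ≤ M)
    {ℓ₀ : ℕ} (hℓ₀ : ℓ₀.Prime) (y₀ : galH1Torsion (twin W K) (lvl 1)) (u : galH1Torsion W (lvl 1))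
    (hu : ∀ v, v ≠ pl ℓ₀ → u ∈ loc₁ W 1 v)
    (uu : ℕ → galH1Torsion W (lvl 1)) (w : ℕ → galH1Torsion (twin W K) (lvl 1))
    (h43 : ∀ ℓ, kolPrime W K M ℓ → ℓ ≠ ℓ₀ → ∀ v, v ≠ pl ℓ₀ → v ≠ pl ℓ → uu ℓ ∈ loc₁ W 1 v)
    (h44sel : ∀ ℓ, kolPrime W K M ℓ → ℓ ≠ ℓ₀ → (uu ℓ ∈ loc₁ W 1 (pl ℓ) ↔ y₀ ∈ a₂ W K 1 ℓ))
    (h44ord : ∀ ℓ, kolPrime W K M ℓ → ℓ ≠ ℓ₀ → (uu ℓ ∈ a₁ W 1 ℓ₀ ↔ w ℓ ∈ a₂ W K 1 ℓ₀))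
    (hu0 : torsionH1OfDvd W (lvl_one_dvd_lvl hM) u ≠ 0)
    (hy0 : torsionH1OfDvd (twin W K) (lvl_one_dvd_lvl hM) y₀ ≠ 0)
    (hvis : ∀ a₁' a₂' : ℤ, rK₁ W K M (a₁' • torsionH1OfDvd W (lvl_one_dvd_lvl hM) u) +
      rK₂ W M hθ hθsq (a₂' • torsionH1OfDvd (twin W K) (lvl_one_dvd_lvl hM) y₀) = 0 →
      a₁' • torsionH1OfDvd W (lvl_one_dvd_lvl hM) u = 0 ∧
        a₂' • torsionH1OfDvd (twin W K) (lvl_one_dvd_lvl hM) y₀ = 0)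
    (b : ℕ) :
    ∃ ℓ, b < ℓ ∧ kolPrime W K M ℓ ∧ ℓ ≠ ℓ₀ ∧ w ℓ ∉ a₂ W K 1 ℓ₀ := by
  have _hΓc : ∀ (L : Type) [Field L], CompactSpace (absoluteGaloisGroup L) :=
    fun L _ => absoluteGaloisGroup_compactSpace L
  -- a Weil pairing on `E[2]` (level `lvl 1 = 2^1`)
  haveI : NeZero (2 ^ 1) := ⟨by norm_num⟩
  have hq2 : 2 ≤ 2 ^ 1 := le_rfl
  have hqK : ((2 ^ 1 : ℕ) : ℚ) ≠ 0 := by norm_num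
  obtain ⟨e, hμ, hadd₁, hadd₂, halt, hnondeg, hgal⟩ := W.exists_weilPairing_holds (2 ^ 1) hq2 hqK
  -- the local non-vanishing predicate `a_v ∪ c_v ≠ 0` at the place of a prime `ℓ`
  set NZ : ℕ → galH1Torsion W (lvl 1) → galH1Torsion W (lvl 1) → Prop := fun ℓ a c ↦
    ∀ hℓ : ℓ.Prime,
      ((weilContPairing W (2 ^ 1) e hμ hadd₁ hadd₂ hgal).restrict
        (absGaloisRestrict ℚ ((primesEquiv.symm ⟨ℓ, hℓ⟩ : HeightOneSpectrum (𝓞 ℚ)).adicCompletion ℚ))).cupProduct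
          (galoisCohomology.localization (W.torsionGaloisModule ((2 ^ 1 : ℕ) : ℤ))
            (Sum.inr (primesEquiv.symm ⟨ℓ, hℓ⟩)) 1 a)
          (galoisCohomology.localization (W.torsionGaloisModule ((2 ^ 1 : ℕ) : ℤ))
            (Sum.inr (primesEquiv.symm ⟨ℓ, hℓ⟩)) 1 c) ≠ 0
    with hNZ
  refine exists_deep_certificate_of_shallow_of_transfer (kolPrime W K M) pl ℓ₀ (loc₁ W 1) (a₁ W 1)
    (a₂ W K 1) y₀ u hu uu w (fun ℓ hℓ hne ↦ pl_ne_pl_of_ne hℓ.1 hℓ₀ hne)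
    (exists_kolPrime_not_mem_of_visible_pair W K M hθ hθsq hcm hΔ hK hodd hns hρ hM u y₀ hu0 hy0 hvis)
    h43 h44sel h44ord NZ (fun ℓ hkol hne a c ha hc ↦ ?_) (fun ℓ hkol a c ha hc hc0 ↦ ?_)
    (fun a c ha ↦ ?_) b
  · -- `hrec`: two-place reciprocity (Poitou–Tate over `ℚ`)
    have hℓ : ℓ.Prime := hkol.1
    obtain ⟨hafin, hainf⟩ := selmer_off_of_forall_ne_pl W hℓ₀ hℓ ha
    obtain ⟨hcfin, hcinf⟩ := selmer_off_of_forall_ne_pl W hℓ₀ hℓ (fun v hv _ ↦ hc v hv)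
    have hv : (primesEquiv.symm ⟨ℓ₀, hℓ₀⟩ : HeightOneSpectrum (𝓞 ℚ)) ≠ primesEquiv.symm ⟨ℓ, hℓ⟩ :=
      fun h ↦ hne (congrArg Subtype.val (primesEquiv.symm.injective h)).symm
    have hiff := cupProduct_localization_eq_zero_iff_of_selmer_off_pair' W e hμ hadd₁ hadd₂ halt hgal
      _ _ hv hafin hainf hcfin hcinf
    simp only [hNZ]
    constructor
    · intro h hℓ' h0
      exact h hℓ₀ (hiff.mpr h0)
    · intro h hℓ₀' h0
      exact h hℓ (hiff.mp h0)
  · -- `hndeg`: Lemma 5.3 at the bottom level, `#E(ℚ_ℓ)[2] = 2`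
    obtain ⟨hℓ, hℓ2, hℓd, hgood, hFM, hF2, hidx, hinert⟩ := hkol
    haveI : Fact ℓ.Prime := ⟨hℓ⟩
    intro hℓ'
    set v : HeightOneSpectrum (𝓞 ℚ) := primesEquiv.symm ⟨ℓ, hℓ'⟩ with hvdef
    have hℓv : (ℓ : 𝓞 ℚ) ∈ v.asIdeal := natCast_mem_primesEquiv_symm hℓ'
    have h2v : ((2 : ℕ) : 𝓞 ℚ) ∉ v.asIdeal := LocalDualityOrder.two_notMem_of_odd_prime_mem hℓ2 hℓv
    have hcard : Nat.card (nsmulAddMonoidHom (2 ^ 1) :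
        (W.baseChange (v.adicCompletion ℚ)).toAffine.Point →+ _).ker = 2 := by
      rw [← zsmulAddGroupHom_natCast]
      have h := ReductionCyclic.natCard_ker_zsmul_adicCompletion_two_pow_eq W hΔ hℓ2 hgood hF2 hℓv
        (M := 1) (le_trans hM hidx)
      rwa [pow_one] at h
    have ha' : a ∉ selmerLocalKer W (v.adicCompletion ℚ) (lvl 1) := by
      rwa [pl_of_prime hℓ', mem_loc₁_inl_iff] at ha
    have hc' : c ∈ selmerLocalKer W (v.adicCompletion ℚ) (lvl 1) := by
      rwa [pl_of_prime hℓ', mem_loc₁_inl_iff] at hc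
    have hc0' : c ∉ W.torsionLocalKer (v.adicCompletion ℚ) (lvl 1) := by
      rwa [mem_a₁_iff hℓ'] at hc0
    exact cupProduct_localization_ne_zero_of_not_mem_of_mem W Nat.prime_two one_ne_zero
      (rfl : 2 ^ 1 = 2 ^ 1) e hμ hadd₁ hadd₂ halt hnondeg hgal v h2v hcard ha' hc' hc0'
  · -- `hstrict`: a class vanishing at `λ₀` pairs to zero there
    intro hNZ'
    apply hNZ' hℓ₀
    have ha' : a ∈ W.torsionLocalKer
        ((primesEquiv.symm ⟨ℓ₀, hℓ₀⟩ : HeightOneSpectrum (𝓞 ℚ)).adicCompletion ℚ) (lvl 1) :=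
      (mem_a₁_iff hℓ₀ a).mp ha
    exact cupProduct_localization_eq_zero_of_mem_torsionLocalKer W e hμ hadd₁ hadd₂ hgal _ ha' c

/-- **The deep certificate, read at level `2^M`**: with the link `hlink` (`c_1(ℓ)_{λ₀} ≠ 0 ⟹
2^{M−1}·c₂(ℓ) ≠ 0` — `c_1(ℓ) ≠ 0` through Lemma 4.6, `ι c_1(ℓ) = 2^{M−1} c_M(ℓ)`), the deepening yields a
Kolyvagin prime `ℓ` of the instance with **`2^{M−1}·c₂ ℓ ≠ 0`** — the inputs `hℓ₀`, `hc₀` of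
`VisiblePairHypothesesM.sel₁_eq_and_card_sel₂_eq_of_primitive` for `visiblePair`.
[cite: McCallumLMS1991, §5 Prop. 5.2, §4 Lemma 4.6, Thm. 5.4] -/
theorem exists_kolPrime_pow_zsmul_ne_zero (hcm : ¬ W.HasCM) (hΔ : W.Δ < 0) (hK : IsImaginaryQuadratic K)
    (hodd : Odd (NumberField.discr K)) (hns : ¬ IsSquare ((NumberField.discr K : ℚ) * -|W.Δ|))
    (hρ : ∀ n : ℕ, W.HasSurjectiveModNGaloisRep (2 ^ n : ℕ)) [(twin W K).IsElliptic] (hM : 1 ≤ M)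
    {ℓ₀ : ℕ} (hℓ₀ : ℓ₀.Prime) (y₀ : galH1Torsion (twin W K) (lvl 1)) (u : galH1Torsion W (lvl 1))
    (hu : ∀ v, v ≠ pl ℓ₀ → u ∈ loc₁ W 1 v)
    (uu : ℕ → galH1Torsion W (lvl 1)) (w : ℕ → galH1Torsion (twin W K) (lvl 1))
    (h43 : ∀ ℓ, kolPrime W K M ℓ → ℓ ≠ ℓ₀ → ∀ v, v ≠ pl ℓ₀ → v ≠ pl ℓ → uu ℓ ∈ loc₁ W 1 v)
    (h44sel : ∀ ℓ, kolPrime W K M ℓ → ℓ ≠ ℓ₀ → (uu ℓ ∈ loc₁ W 1 (pl ℓ) ↔ y₀ ∈ a₂ W K 1 ℓ))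
    (h44ord : ∀ ℓ, kolPrime W K M ℓ → ℓ ≠ ℓ₀ → (uu ℓ ∈ a₁ W 1 ℓ₀ ↔ w ℓ ∈ a₂ W K 1 ℓ₀))
    (hu0 : torsionH1OfDvd W (lvl_one_dvd_lvl hM) u ≠ 0)
    (hy0 : torsionH1OfDvd (twin W K) (lvl_one_dvd_lvl hM) y₀ ≠ 0)
    (hvis : ∀ a₁' a₂' : ℤ, rK₁ W K M (a₁' • torsionH1OfDvd W (lvl_one_dvd_lvl hM) u) +
      rK₂ W M hθ hθsq (a₂' • torsionH1OfDvd (twin W K) (lvl_one_dvd_lvl hM) y₀) = 0 →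
      a₁' • torsionH1OfDvd W (lvl_one_dvd_lvl hM) u = 0 ∧
        a₂' • torsionH1OfDvd (twin W K) (lvl_one_dvd_lvl hM) y₀ = 0)
    (c₂ : ℕ → galH1Torsion (twin W K) (lvl M))
    (hlink : ∀ ℓ, kolPrime W K M ℓ → ℓ ≠ ℓ₀ → w ℓ ∉ a₂ W K 1 ℓ₀ → ((2 : ℤ) ^ (M - 1)) • c₂ ℓ ≠ 0) :
    ∃ ℓ, kolPrime W K M ℓ ∧ ((2 : ℤ) ^ (M - 1)) • c₂ ℓ ≠ 0 := by
  obtain ⟨ℓ, -, hkol, hne, hw⟩ := exists_deep_certificate W K M hθ hθsq hcm hΔ hK hodd hns hρ hM hℓ₀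
    y₀ u hu uu w h43 h44sel h44ord hu0 hy0 hvis 0
  exact ⟨ℓ, hkol, hlink ℓ hkol hne hw⟩

end Summit.BirchSwinnertonDyer.BirchSwinnertonDyer.Theorems.GenusExact.VisiblePairAtTwo

end
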